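import Summits.ValiantsHypothesis.ValiantsHypothesis.Theorems.BarrierLeverPriorityPeelingLayoutsSmallRank

/-!
# Route BarrierLever — priority peeling for TT: SYMMETRIES of derivations

Helper file (`--supports stmt-ValiantsHypothesis-19761`; cell valiant-natproofs, rung V4, 𝒟-side door
(c); prover val-np-p1 g7). Closes NO item. Two invariance properties of prover gen 7's certificate
format `PriorityPeeling.PPDerivable nr nc ι e R C` (p460060), both by induction on the derivation:

* `PPDerivable.relabel` — LITERAL RELABELING: composing all row index maps with an injective
  `f : Fin nr → Fin nr'` and all column index maps with an injective `g : Fin nc → Fin nc'` preserves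
  derivability (pair move: split literals `f ℓ₀, f ℓ₁`, marked sets `P.image g, S.image g`, weight
  `Function.extend g w 0`; shear: `g x, g y` and `Function.comp_update`);
* `PPDerivable.slotPerm` — SLOT PERMUTATIONS: pre-composing each row map `R i` with its own
  permutation `α i` of the slots `Fin e` and each column map with `β j` preserves derivability (pair
  move: the split slot becomes `(α i)⁻¹ (pos i)`, and the child slot maps factor through
  `Fin.succAbove` by a permutation of `Fin d` — `exists_perm_succAbove`, from
  `PPSmall.exists_perm_of_forall_exists`; shear: `Function.update_comp_eq_of_injective`);
* `PPDerivable.transport` — the combination with re-indexing used by the small-`h` rungs: a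
  configuration `R i = f ∘ R₀ (σ i) ∘ α`, `C j = g ∘ C₀ (τ j) ∘ β` of a derivable `(R₀, C₀)` is
  derivable. For TT layouts this realises the hyperoctahedral symmetries (coordinate permutations and
  per-coordinate flips, independently on the row side and on the column side), which cut the `h = 3`
  rung to `B₃ × B₃`-orbit representatives (sibling files `…LayoutsThree*`).

Item 19761's own closure clause (0) has re-indexing and slot permutations but no literal relabeling;
the lemmas here are about gen 7's derivations, upstream of the bridge p467389.

WHAT THIS IS NOT: bookkeeping; nothing on 19761 / TT (19152) in general, on crux
stmt-ValiantsHypothesis-14610, or on VP versus VNP.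
-/

-- layout Summits/ValiantsHypothesis/ValiantsHypothesis forces the duplicated namespace component
set_option linter.dupNamespace false

namespace Summit.ValiantsHypothesis.ValiantsHypothesis.Theorems.BarrierLever.PriorityPeeling

/-! ## 1. Literal relabeling -/

/-- **Literal relabeling.** Injective maps on the row literals and on the column literals transport
priority-peeling derivations. -/
theorem PPDerivable.relabel {nr nc : ℕ} {ι : Type} [Fintype ι] [DecidableEq ι] {e : ℕ}
    {R : ι → Fin e → Fin nr} {C : ι → Fin e → Fin nc} (h : PPDerivable nr nc ι e R C) :
    ∀ {nr' nc' : ℕ} (f : Fin nr → Fin nr') (g : Fin nc → Fin nc'), Function.Injective f →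
      Function.Injective g → PPDerivable nr' nc' ι e (fun i => f ∘ R i) (fun j => g ∘ C j) := by
  induction h with
  | @rank_zero nr nc ι _ _ hsub R C =>
    intro nr' nc' f g hf hg
    exact PPDerivable.rank_zero _ _
  | rank_one R C hR hC =>
    intro nr' nc' f g hf hg
    exact PPDerivable.rank_one _ _ (hf.comp hR) (hg.comp hC)
  | single R C i₀ hι hR hC =>
    intro nr' nc' f g hf hg
    exact PPDerivable.single _ _ i₀ hι (hf.comp hR) (hg.comp hC)
  | pair R C ℓ₀ ℓ₁ hℓ b pos hpos huniq P S w grp qφ hφ₀ hφ₁ fp hfp _ _ ih₀ ih₁ =>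
    intro nr' nc' f g hf hg
    have hpos' : ∀ i, (f ∘ R i) (pos i) = if b i then f ℓ₁ else f ℓ₀ := by
      intro i
      rw [Function.comp_apply, hpos]
      split <;> rfl
    have huniq' : ∀ i a, a ≠ pos i → (f ∘ R i) a ≠ f ℓ₀ ∧ (f ∘ R i) a ≠ f ℓ₁ := fun i a ha =>
      ⟨hf.ne (huniq i a ha).1, hf.ne (huniq i a ha).2⟩
    have hw : ∀ x, Function.extend g w 0 (g x) = w x := fun x => hg.extend_apply _ _ _
    have hφ₀' : ∀ j, grp j = false → (g ∘ C j) (qφ j) ∈ P.image g ∧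
        ∀ q, (g ∘ C j) q ∈ P.image g → q ≠ qφ j →
          Function.extend g w 0 ((g ∘ C j) q) < Function.extend g w 0 ((g ∘ C j) (qφ j)) := by
      intro j hj
      obtain ⟨h1, h2⟩ := hφ₀ j hj
      refine ⟨hg.mem_finset_image.mpr h1, fun q hq hne => ?_⟩
      rw [Function.comp_apply, Function.comp_apply, hw, hw]
      exact h2 q (hg.mem_finset_image.mp hq) hne
    have hφ₁' : ∀ j, grp j = true → (∀ q, (g ∘ C j) q ∉ P.image g) ∧ (g ∘ C j) (qφ j) ∈ S.image g ∧
        ∀ q, (g ∘ C j) q ∈ S.image g → q ≠ qφ j →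
          Function.extend g w 0 ((g ∘ C j) q) < Function.extend g w 0 ((g ∘ C j) (qφ j)) := by
      intro j hj
      obtain ⟨h1, h2, h3⟩ := hφ₁ j hj
      refine ⟨fun q hq => h1 q (hg.mem_finset_image.mp hq), hg.mem_finset_image.mpr h2,
        fun q hq hne => ?_⟩
      rw [Function.comp_apply, Function.comp_apply, hw, hw]
      exact h3 q (hg.mem_finset_image.mp hq) hne
    exact PPDerivable.pair _ _ (f ℓ₀) (f ℓ₁) (hf.ne hℓ) b pos hpos' huniq' (P.image g) (S.image g)
      (Function.extend g w 0) grp qφ hφ₀' hφ₁' fp hfp (ih₀ f g hf hg) (ih₁ f g hf hg)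
  | shear R C hC x y hxy aff qx haff hunaff _ ih =>
    intro nr' nc' f g hf hg
    have hC' : ∀ j, Function.Injective (g ∘ C j) := fun j => hg.comp (hC j)
    have haff' : ∀ j, aff j = true → (g ∘ C j) (qx j) = g x ∧ ∀ q, (g ∘ C j) q ≠ g y :=
      fun j hj => ⟨by rw [Function.comp_apply, (haff j hj).1], fun q => hg.ne ((haff j hj).2 q)⟩
    have hunaff' : ∀ j, aff j = false → (∀ q, (g ∘ C j) q ≠ g x) ∨ (∃ q, (g ∘ C j) q = g y) :=
      fun j hj => (hunaff j hj).imp (fun h q => hg.ne (h q))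
        (fun ⟨q, hq⟩ => ⟨q, by rw [Function.comp_apply, hq]⟩)
    have e1 : (fun j => g ∘ (if aff j then Function.update (C j) (qx j) y else C j)) =
        (fun j => if aff j then Function.update (g ∘ C j) (qx j) (g y) else g ∘ C j) := by
      funext j
      split
      · rw [Function.comp_update]
      · rfl
    exact PPDerivable.shear _ _ hC' (g x) (g y) (hg.ne hxy) aff qx haff' hunaff' (e1 ▸ ih f g hf hg)
  | transpose R C _ ih =>
    intro nr' nc' f g hf hg
    exact PPDerivable.transpose _ _ (ih g f hg hf)
  | reindex R C σ τ _ ih =>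
    intro nr' nc' f g hf hg
    exact PPDerivable.reindex _ _ σ τ (ih f g hf hg)

/-! ## 2. Slot permutations -/

/-- An injective map into `Fin (d + 1)` composed after `succAbove` of the preimage of `p` under a
permutation `θ` factors through `p.succAbove` by a permutation of `Fin d`. -/
theorem exists_perm_succAbove {d : ℕ} (θ : Equiv.Perm (Fin (d + 1))) (p : Fin (d + 1)) :
    ∃ γ : Equiv.Perm (Fin d), ∀ x, θ ((θ.symm p).succAbove x) = p.succAbove (γ x) := by
  have hm : ∀ x, ∃ y, θ ((θ.symm p).succAbove x) = p.succAbove y := by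
    intro x
    have hne : θ ((θ.symm p).succAbove x) ≠ p := by
      intro h
      have h' : (θ.symm p).succAbove x = θ.symm p :=
        θ.injective (h.trans (θ.apply_symm_apply p).symm)
      exact Fin.succAbove_ne _ _ h'
    obtain ⟨z, hz⟩ := Fin.exists_succAbove_eq hne
    exact ⟨z, hz.symm⟩
  exact PPSmall.exists_perm_of_forall_exists hm
    (θ.injective.comp Fin.succAbove_right_injective)

/-- **Slot permutations.** Pre-composing every row index map and every column index map with its
own permutation of the slots preserves derivability. -/
theorem PPDerivable.slotPerm {nr nc : ℕ} {ι : Type} [Fintype ι] [DecidableEq ι] {e : ℕ}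
    {R : ι → Fin e → Fin nr} {C : ι → Fin e → Fin nc} (h : PPDerivable nr nc ι e R C) :
    ∀ (α β : ι → Equiv.Perm (Fin e)),
      PPDerivable nr nc ι e (fun i => R i ∘ α i) (fun j => C j ∘ β j) := by
  induction h with
  | @rank_zero nr nc ι _ _ hsub R C =>
    intro α β
    exact PPDerivable.rank_zero _ _
  | rank_one R C hR hC =>
    intro α β
    have hα : ∀ i, α i 0 = 0 := fun i => Subsingleton.elim _ _
    have hβ : ∀ j, β j 0 = 0 := fun j => Subsingleton.elim _ _
    refine PPDerivable.rank_one _ _ (fun i j hij => hR ?_) (fun i j hij => hC ?_)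
    · simpa only [Function.comp_apply, hα] using hij
    · simpa only [Function.comp_apply, hβ] using hij
  | single R C i₀ hι hR hC =>
    intro α β
    exact PPDerivable.single _ _ i₀ hι (hR.comp (α i₀).injective) (hC.comp (β i₀).injective)
  | pair R C ℓ₀ ℓ₁ hℓ b pos hpos huniq P S w grp qφ hφ₀ hφ₁ fp hfp _ _ ih₀ ih₁ =>
    intro α β
    -- the new split slots
    have hpos' : ∀ i, (R i ∘ α i) ((α i).symm (pos i)) = if b i then ℓ₁ else ℓ₀ := by
      intro i
      rw [Function.comp_apply, Equiv.apply_symm_apply, hpos]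
    have huniq' : ∀ i a, a ≠ (α i).symm (pos i) → (R i ∘ α i) a ≠ ℓ₀ ∧ (R i ∘ α i) a ≠ ℓ₁ := by
      intro i a ha
      refine huniq i (α i a) (fun h => ha ?_)
      rw [← h, Equiv.symm_apply_apply]
    have hφ₀' : ∀ j, grp j = false → (C j ∘ β j) ((β j).symm (qφ j)) ∈ P ∧
        ∀ q, (C j ∘ β j) q ∈ P → q ≠ (β j).symm (qφ j) →
          w ((C j ∘ β j) q) < w ((C j ∘ β j) ((β j).symm (qφ j))) := by
      intro j hj
      obtain ⟨h1, h2⟩ := hφ₀ j hj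
      refine ⟨by rw [Function.comp_apply, Equiv.apply_symm_apply]; exact h1, fun q hq hne => ?_⟩
      rw [Function.comp_apply, Function.comp_apply, Equiv.apply_symm_apply]
      refine h2 (β j q) hq (fun h => hne ?_)
      rw [← h, Equiv.symm_apply_apply]
    have hφ₁' : ∀ j, grp j = true → (∀ q, (C j ∘ β j) q ∉ P) ∧ (C j ∘ β j) ((β j).symm (qφ j)) ∈ S ∧
        ∀ q, (C j ∘ β j) q ∈ S → q ≠ (β j).symm (qφ j) →
          w ((C j ∘ β j) q) < w ((C j ∘ β j) ((β j).symm (qφ j))) := by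
      intro j hj
      obtain ⟨h1, h2, h3⟩ := hφ₁ j hj
      refine ⟨fun q => h1 (β j q), by rw [Function.comp_apply, Equiv.apply_symm_apply]; exact h2,
        fun q hq hne => ?_⟩
      rw [Function.comp_apply, Function.comp_apply, Equiv.apply_symm_apply]
      refine h3 (β j q) hq (fun h => hne ?_)
      rw [← h, Equiv.symm_apply_apply]
    -- the child slot permutations
    choose γ hγ using fun i => exists_perm_succAbove (α i) (pos i)
    choose δ hδ using fun j => exists_perm_succAbove (β j) (qφ j)
    refine PPDerivable.pair _ _ ℓ₀ ℓ₁ hℓ b (fun i => (α i).symm (pos i)) hpos' huniq' P S w grp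
      (fun j => (β j).symm (qφ j)) hφ₀' hφ₁' fp hfp ?_ ?_
    · have e1 : (fun i : {x : _ // b x = false} => (R i ∘ α i) ∘ ((α i).symm (pos i)).succAbove) =
          fun i : {x : _ // b x = false} => (R i ∘ (pos i).succAbove) ∘ γ i := by
        funext i x
        simp only [Function.comp_apply, hγ]
      have e2 : (fun j : {x : _ // b x = false} =>
          (C (fp j) ∘ β (fp j)) ∘ ((β (fp j)).symm (qφ (fp j))).succAbove) =
          fun j : {x : _ // b x = false} => (C (fp j) ∘ (qφ (fp j)).succAbove) ∘ δ (fp j) := by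
        funext j x
        simp only [Function.comp_apply, hδ]
      rw [e1, e2]
      exact ih₀ (fun i => γ i) (fun j => δ (fp j))
    · have e1 : (fun i : {x : _ // ¬ b x = false} =>
          (R i ∘ α i) ∘ ((α i).symm (pos i)).succAbove) =
          fun i : {x : _ // ¬ b x = false} => (R i ∘ (pos i).succAbove) ∘ γ i := by
        funext i x
        simp only [Function.comp_apply, hγ]
      have e2 : (fun j : {x : _ // ¬ b x = false} =>
          (C (fp j) ∘ β (fp j)) ∘ ((β (fp j)).symm (qφ (fp j))).succAbove) =
          fun j : {x : _ // ¬ b x = false} => (C (fp j) ∘ (qφ (fp j)).succAbove) ∘ δ (fp j) := by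
        funext j x
        simp only [Function.comp_apply, hδ]
      rw [e1, e2]
      exact ih₁ (fun i => γ i) (fun j => δ (fp j))
  | shear R C hC x y hxy aff qx haff hunaff _ ih =>
    intro α β
    have hC' : ∀ j, Function.Injective (C j ∘ β j) := fun j => (hC j).comp (β j).injective
    have haff' : ∀ j, aff j = true → (C j ∘ β j) ((β j).symm (qx j)) = x ∧ ∀ q, (C j ∘ β j) q ≠ y :=
      fun j hj => ⟨by rw [Function.comp_apply, Equiv.apply_symm_apply]; exact (haff j hj).1,
        fun q => (haff j hj).2 (β j q)⟩
    have hunaff' : ∀ j, aff j = false → (∀ q, (C j ∘ β j) q ≠ x) ∨ (∃ q, (C j ∘ β j) q = y) :=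
      fun j hj => (hunaff j hj).imp (fun h q => h (β j q))
        (fun ⟨q, hq⟩ => ⟨(β j).symm q, by rw [Function.comp_apply, Equiv.apply_symm_apply, hq]⟩)
    have e1 : (fun j => (if aff j then Function.update (C j) (qx j) y else C j) ∘ β j) =
        (fun j => if aff j then Function.update (C j ∘ β j) ((β j).symm (qx j)) y else C j ∘ β j) := by
      funext j
      split
      · conv_lhs => rw [← (β j).apply_symm_apply (qx j)]
        rw [Function.update_comp_eq_of_injective _ (β j).injective]
      · rfl
    exact PPDerivable.shear _ _ hC' x y hxy aff (fun j => (β j).symm (qx j)) haff' hunaff'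
      (e1 ▸ ih α β)
  | transpose R C _ ih =>
    intro α β
    exact PPDerivable.transpose _ _ (ih β α)
  | reindex R C σ τ _ ih =>
    intro α β
    exact PPDerivable.reindex _ _ σ τ (ih (fun i => α (σ i)) (fun j => β (τ j)))

/-! ## 3. Transport along all three symmetries -/

/-- **Transport.** If `(R₀, C₀)` on `Fin r` is derivable and `R i = f ∘ R₀ (σ i) ∘ α`,
`C j = g ∘ C₀ (τ j) ∘ β` for injective literal maps `f, g`, slot permutations `α, β` and index
permutations `σ, τ`, then `(R, C)` is derivable. -/
theorem PPDerivable.transport {nr nc nr' nc' r e : ℕ} {R₀ : Fin r → Fin e → Fin nr}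
    {C₀ : Fin r → Fin e → Fin nc} (h : PPDerivable nr nc (Fin r) e R₀ C₀)
    (f : Fin nr → Fin nr') (g : Fin nc → Fin nc') (hf : Function.Injective f)
    (hg : Function.Injective g) (α β : Equiv.Perm (Fin e)) (σ τ : Equiv.Perm (Fin r))
    (R : Fin r → Fin e → Fin nr') (C : Fin r → Fin e → Fin nc')
    (hR : ∀ i, R i = f ∘ R₀ (σ i) ∘ α) (hC : ∀ j, C j = g ∘ C₀ (τ j) ∘ β) :
    PPDerivable nr' nc' (Fin r) e R C := by
  have h1 := (h.slotPerm (fun _ => α) (fun _ => β)).relabel f g hf hg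
  exact PPSmall.ppDerivable_of_perm R (fun i => f ∘ (R₀ i ∘ α)) C (fun j => g ∘ (C₀ j ∘ β)) σ τ
    hR hC h1

end Summit.ValiantsHypothesis.ValiantsHypothesis.Theorems.BarrierLever.PriorityPeeling
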